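import Summits.CriticalPhenomena.PercolationContinuityZ3.Theorems.PercNearOneGluingAdditiveGluingChartSPointwise
import HarnessLib

/-!
# Crux `PercNearOneGluing.AdditiveGluing` (stmt-CriticalPhenomena-4576): CHART S of the refined-coordinate atlas (seat (d) exchange-certificate form, gen 3)

Support file (`--supports stmt-CriticalPhenomena-4576`); no definitions, no named facts, no sorries.

**Chart S**: for three relays with `a₃` worst, `τ₁ ≤ τ₂` and `m₂₃ ≤ m₁`, if `φ'₁ ≤ 1/2` and the other five refined
attachments lie in `[1/2, 3/4]` then `μ(o ↔ A ∖ o ↔ b) ≤ μ(a₃ ↮ b)` (residual class "exactly one single attachment ≤ 1/2", moderate part).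
Certificate: 21 constant rational multipliers over the same atom shapes as chart Q.
[cite: KozmaNitzan2024, Theorem 2 (§3.1, pp. 8–9), Lemma 3 (pp. 6–7); VandenbergHaggstromKahn2005, Thm. 1.3, Thm. 1.4 (p. 7)]
-/

namespace Summit.CriticalPhenomena.PercolationContinuityZ3.Theorems

open MeasureTheory Set Literature.Probability.LatticeModels Literature.Probability.Percolation
open scoped Classical

set_option maxHeartbeats 4000000 in
/-- **Chart S** (`a₃` worst, `τ₁ ≤ τ₂`, `m₂₃ ≤ m₁`): `φ'₁ ≤ 1/2` and `φ'₂,φ'₃,φ'₁₂,φ'₁₃,φ'₂₃ ∈ [1/2, 3/4]` ⇒ `μ((o↔a₁ ∪ o↔a₂ ∪ o↔a₃) ∖ o↔b) ≤ μ(a₃ ↮ b)` (division-free box hypotheses on the six `μ(N'_S ∩ F_S)` vs `μ(N'_S)`). [cite: KozmaNitzan2024, Theorem 2 (§3.1, pp. 8–9), Lemma 3 (pp. 6–7); VandenbergHaggstromKahn2005, Thm. 1.3, Thm. 1.4 (p. 7)] -/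
theorem eform3_chartS {n : ℕ} (w : Sym2 (Fin n) → unitInterval) (o b a₁ a₂ a₃ : Fin n)
    (h12 : a₁ ≠ a₂) (h13 : a₁ ≠ a₃) (h23 : a₂ ≠ a₃) (ho1 : o ≠ a₁) (ho2 : o ≠ a₂) (ho3 : o ≠ a₃)
    (hτ31 : (prodBernoulli w).real (openConn a₃ b) ≤ (prodBernoulli w).real (openConn a₁ b))
    (hτ32 : (prodBernoulli w).real (openConn a₃ b) ≤ (prodBernoulli w).real (openConn a₂ b))
    (hτ12 : (prodBernoulli w).real (openConn a₁ b) ≤ (prodBernoulli w).real (openConn a₂ b))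
    (hU₁ : 2 * (prodBernoulli w).real ((openConn a₁ a₂)ᶜ ∩ (openConn a₁ a₃)ᶜ ∩ ((openConn o a₂)ᶜ ∩ (openConn o a₃)ᶜ) ∩ openConn a₁ o) ≤
      (prodBernoulli w).real ((openConn a₁ a₂)ᶜ ∩ (openConn a₁ a₃)ᶜ ∩ ((openConn o a₂)ᶜ ∩ (openConn o a₃)ᶜ)))
    (hL₂ : (prodBernoulli w).real ((openConn a₂ a₁)ᶜ ∩ (openConn a₂ a₃)ᶜ ∩ ((openConn o a₁)ᶜ ∩ (openConn o a₃)ᶜ)) ≤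
      2 * (prodBernoulli w).real ((openConn a₂ a₁)ᶜ ∩ (openConn a₂ a₃)ᶜ ∩ ((openConn o a₁)ᶜ ∩ (openConn o a₃)ᶜ) ∩ openConn a₂ o))
    (hU₂ : 4 * (prodBernoulli w).real ((openConn a₂ a₁)ᶜ ∩ (openConn a₂ a₃)ᶜ ∩ ((openConn o a₁)ᶜ ∩ (openConn o a₃)ᶜ) ∩ openConn a₂ o) ≤
      3 * (prodBernoulli w).real ((openConn a₂ a₁)ᶜ ∩ (openConn a₂ a₃)ᶜ ∩ ((openConn o a₁)ᶜ ∩ (openConn o a₃)ᶜ)))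
    (hL₃ : (prodBernoulli w).real ((openConn a₃ a₁)ᶜ ∩ (openConn a₃ a₂)ᶜ ∩ ((openConn o a₁)ᶜ ∩ (openConn o a₂)ᶜ)) ≤
      2 * (prodBernoulli w).real ((openConn a₃ a₁)ᶜ ∩ (openConn a₃ a₂)ᶜ ∩ ((openConn o a₁)ᶜ ∩ (openConn o a₂)ᶜ) ∩ openConn a₃ o))
    (hU₃ : 4 * (prodBernoulli w).real ((openConn a₃ a₁)ᶜ ∩ (openConn a₃ a₂)ᶜ ∩ ((openConn o a₁)ᶜ ∩ (openConn o a₂)ᶜ) ∩ openConn a₃ o) ≤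
      3 * (prodBernoulli w).real ((openConn a₃ a₁)ᶜ ∩ (openConn a₃ a₂)ᶜ ∩ ((openConn o a₁)ᶜ ∩ (openConn o a₂)ᶜ)))
    (hL₂₃ : (prodBernoulli w).real ((openConn a₂ a₁)ᶜ ∩ (openConn a₃ a₁)ᶜ ∩ (openConn o a₁)ᶜ) ≤
      2 * (prodBernoulli w).real ((openConn a₂ a₁)ᶜ ∩ (openConn a₃ a₁)ᶜ ∩ (openConn o a₁)ᶜ ∩ (openConn a₂ o ∪ openConn a₃ o)))
    (hU₂₃ : 4 * (prodBernoulli w).real ((openConn a₂ a₁)ᶜ ∩ (openConn a₃ a₁)ᶜ ∩ (openConn o a₁)ᶜ ∩ (openConn a₂ o ∪ openConn a₃ o)) ≤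
      3 * (prodBernoulli w).real ((openConn a₂ a₁)ᶜ ∩ (openConn a₃ a₁)ᶜ ∩ (openConn o a₁)ᶜ))
    (hL₁₂ : (prodBernoulli w).real ((openConn a₁ a₃)ᶜ ∩ (openConn a₂ a₃)ᶜ ∩ (openConn o a₃)ᶜ) ≤
      2 * (prodBernoulli w).real ((openConn a₁ a₃)ᶜ ∩ (openConn a₂ a₃)ᶜ ∩ (openConn o a₃)ᶜ ∩ (openConn a₁ o ∪ openConn a₂ o)))
    (hU₁₂ : 4 * (prodBernoulli w).real ((openConn a₁ a₃)ᶜ ∩ (openConn a₂ a₃)ᶜ ∩ (openConn o a₃)ᶜ ∩ (openConn a₁ o ∪ openConn a₂ o)) ≤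
      3 * (prodBernoulli w).real ((openConn a₁ a₃)ᶜ ∩ (openConn a₂ a₃)ᶜ ∩ (openConn o a₃)ᶜ))
    (hL₁₃ : (prodBernoulli w).real ((openConn a₁ a₂)ᶜ ∩ (openConn a₃ a₂)ᶜ ∩ (openConn o a₂)ᶜ) ≤
      2 * (prodBernoulli w).real ((openConn a₁ a₂)ᶜ ∩ (openConn a₃ a₂)ᶜ ∩ (openConn o a₂)ᶜ ∩ (openConn a₁ o ∪ openConn a₃ o)))
    (hU₁₃ : 4 * (prodBernoulli w).real ((openConn a₁ a₂)ᶜ ∩ (openConn a₃ a₂)ᶜ ∩ (openConn o a₂)ᶜ ∩ (openConn a₁ o ∪ openConn a₃ o)) ≤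
      3 * (prodBernoulli w).real ((openConn a₁ a₂)ᶜ ∩ (openConn a₃ a₂)ᶜ ∩ (openConn o a₂)ᶜ))
    (hreg : (prodBernoulli w).real (openConn b a₂ ∩ openConn b a₃ ∩ (openConn b a₁)ᶜ) ≤
      (prodBernoulli w).real (openConn b a₁ ∩ (openConn b a₂)ᶜ ∩ (openConn b a₃)ᶜ)) :
    (prodBernoulli w).real ((openConn o a₁ ∪ openConn o a₂ ∪ openConn o a₃) \ openConn o b) ≤
      (prodBernoulli w).real ((openConn a₃ b)ᶜ) := by
  obtain ⟨p₁, hp₁lo, hp₁hi, hidp₁, g1, g2, g5⟩ : ∃ P : ℝ, 0 ≤ P ∧ P ≤ 1 / 2 ∧ (prodBernoulli w).real ((openConn a₁ a₂)ᶜ ∩ (openConn a₁ a₃)ᶜ ∩ ((openConn o a₂)ᶜ ∩ (openConn o a₃)ᶜ) ∩ openConn a₁ o) = P * (prodBernoulli w).real ((openConn a₁ a₂)ᶜ ∩ (openConn a₁ a₃)ᶜ ∩ ((openConn o a₂)ᶜ ∩ (openConn o a₃)ᶜ)) ∧ (prodBernoulli w).real ((openConn a₁ a₂)ᶜ ∩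 (openConn a₁ a₃)ᶜ ∩ ((openConn o a₂)ᶜ ∩ (openConn o a₃)ᶜ) ∩ (openConn a₁ o ∩ openConn a₂ b)) ≤ P * (prodBernoulli w).real ((openConn a₁ a₂)ᶜ ∩ (openConn a₁ a₃)ᶜ ∩ ((openConn o a₂)ᶜ ∩ (openConn o a₃)ᶜ) ∩ openConn a₂ b) ∧ (prodBernoulli w).real ((openConn a₁ a₂)ᶜ ∩ (openConn a₁ a₃)ᶜ ∩ ((openConn o a₂)ᶜ ∩ (openConn o a₃)ᶜ) ∩ (openConn a₁ o ∩ (openConn a₂ b ∩ openConn a₃ b))) ≤ P * (prodBernoulli w).real ((openConn a₁ a₂)ᶜ ∩ (openConn a₁ a₃)ᶜ ∩ ((openConn o a₂)ᶜ ∩ (openConn o a₃)ᶜ) ∩ (openConn a₂ b ∩ openConn a₃ b)) ∧ P * (prodBernoulli w).real ((openConn a₁ a₂)ᶜ ∩ (openConn a₁ a₃)ᶜ ∩ ((openConn o a₂)ᶜ ∩ (openConn o a₃)ᶜ) ∩ openConn a₁ b) ≤ (prodBernoulli w).real ((openConn a₁ a₂)ᶜ ∩ (openConn a₁ a₃)ᶜ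 ∩ ((openConn o a₂)ᶜ ∩ (openConn o a₃)ᶜ) ∩ (openConn a₁ o ∩ openConn a₁ b)) := by
    by_cases hz : (prodBernoulli w).real ((openConn a₁ a₂)ᶜ ∩ (openConn a₁ a₃)ᶜ ∩ ((openConn o a₂)ᶜ ∩ (openConn o a₃)ᶜ)) = 0
    · have hF : (prodBernoulli w).real ((openConn a₁ a₂)ᶜ ∩ (openConn a₁ a₃)ᶜ ∩ ((openConn o a₂)ᶜ ∩ (openConn o a₃)ᶜ) ∩ openConn a₁ o) = 0 := le_antisymm (le_trans (measureReal_mono Set.inter_subset_left) hz.le) measureReal_nonneg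
      refine ⟨(0 : ℝ), ?_, ?_, ?_, ?_, ?_, ?_⟩
      · norm_num
      · norm_num
      · rw [hF, hz, mul_zero]
      · have h1 : (prodBernoulli w).real ((openConn a₁ a₂)ᶜ ∩ (openConn a₁ a₃)ᶜ ∩ ((openConn o a₂)ᶜ ∩ (openConn o a₃)ᶜ) ∩ (openConn a₁ o ∩ openConn a₂ b)) = 0 := le_antisymm (le_trans (measureReal_mono Set.inter_subset_left) hz.le) measureReal_nonneg
        rw [h1]; exact mul_nonneg (by norm_num) measureReal_nonneg
      · have h1 : (prodBernoulli w).real ((openConn a₁ a₂)ᶜ ∩ (openConn a₁ a₃)ᶜ ∩ ((openConn o a₂)ᶜ ∩ (openConn o a₃)ᶜ) ∩ (openConn a₁ o ∩ (openConn a₂ b ∩ openConn a₃ b))) = 0 := le_antisymm (le_trans (measureReal_mono Set.inter_subset_left) hz.le) measureReal_nonneg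
        rw [h1]; exact mul_nonneg (by norm_num) measureReal_nonneg
      · have h1 : (prodBernoulli w).real ((openConn a₁ a₂)ᶜ ∩ (openConn a₁ a₃)ᶜ ∩ ((openConn o a₂)ᶜ ∩ (openConn o a₃)ᶜ) ∩ openConn a₁ b) = 0 := le_antisymm (le_trans (measureReal_mono Set.inter_subset_left) hz.le) measureReal_nonneg
        rw [h1, mul_zero]; exact measureReal_nonneg
    · have hpos : 0 < (prodBernoulli w).real ((openConn a₁ a₂)ᶜ ∩ (openConn a₁ a₃)ᶜ ∩ ((openConn o a₂)ᶜ ∩ (openConn o a₃)ᶜ)) := lt_of_le_of_ne measureReal_nonneg (Ne.symm hz)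
      refine ⟨(prodBernoulli w).real ((openConn a₁ a₂)ᶜ ∩ (openConn a₁ a₃)ᶜ ∩ ((openConn o a₂)ᶜ ∩ (openConn o a₃)ᶜ) ∩ openConn a₁ o) / (prodBernoulli w).real ((openConn a₁ a₂)ᶜ ∩ (openConn a₁ a₃)ᶜ ∩ ((openConn o a₂)ᶜ ∩ (openConn o a₃)ᶜ)), ?_, ?_, ?_, ?_, ?_, ?_⟩
      · exact div_nonneg measureReal_nonneg measureReal_nonneg
      · rw [div_le_iff₀ hpos]; linarith
      · rw [div_mul_cancel₀ _ hpos.ne']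
      · exact chartB_cross w o b a₁ a₂ a₃ h12 h13 ho2 ho3
      · exact chart_crossAll w o b a₁ a₂ a₃ h12 h13 ho2 ho3
      · exact chartP_diagOne w o b a₁ a₂ a₃ h12 h13 ho2 ho3
  obtain ⟨p₂, hp₂lo, hp₂hi, hidp₂, g3, g6⟩ : ∃ P : ℝ, 1 / 2 ≤ P ∧ P ≤ 3 / 4 ∧ (prodBernoulli w).real ((openConn a₂ a₁)ᶜ ∩ (openConn a₂ a₃)ᶜ ∩ ((openConn o a₁)ᶜ ∩ (openConn o a₃)ᶜ) ∩ openConn a₂ o) = P * (prodBernoulli w).real ((openConn a₂ a₁)ᶜ ∩ (openConn a₂ a₃)ᶜ ∩ ((openConn o a₁)ᶜ ∩ (openConn o a₃)ᶜ)) ∧ (prodBernoulli w).real ((openConn a₂ a₁)ᶜ ∩ (openConn a₂ a₃)ᶜ ∩ ((openConn o a₁)ᶜ ∩ (openConn o a₃)ᶜ) ∩ (openConn a₂ o ∩ (openConn a₁ b ∩ openConn a₃ b))) ≤ P * (prodBernoulli w).real ((openConn a₂ a₁)ᶜ ∩ (openConn a₂ a₃)ᶜ ∩ ((openConn o a₁)ᶜ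 ∩ (openConn o a₃)ᶜ) ∩ (openConn a₁ b ∩ openConn a₃ b)) ∧ P * (prodBernoulli w).real ((openConn a₂ a₁)ᶜ ∩ (openConn a₂ a₃)ᶜ ∩ ((openConn o a₁)ᶜ ∩ (openConn o a₃)ᶜ) ∩ openConn a₂ b) ≤ (prodBernoulli w).real ((openConn a₂ a₁)ᶜ ∩ (openConn a₂ a₃)ᶜ ∩ ((openConn o a₁)ᶜ ∩ (openConn o a₃)ᶜ) ∩ (openConn a₂ o ∩ openConn a₂ b)) := by
    by_cases hz : (prodBernoulli w).real ((openConn a₂ a₁)ᶜ ∩ (openConn a₂ a₃)ᶜ ∩ ((openConn o a₁)ᶜ ∩ (openConn o a₃)ᶜ)) = 0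
    · have hF : (prodBernoulli w).real ((openConn a₂ a₁)ᶜ ∩ (openConn a₂ a₃)ᶜ ∩ ((openConn o a₁)ᶜ ∩ (openConn o a₃)ᶜ) ∩ openConn a₂ o) = 0 := le_antisymm (le_trans (measureReal_mono Set.inter_subset_left) hz.le) measureReal_nonneg
      refine ⟨((1 : ℝ) / 2), ?_, ?_, ?_, ?_, ?_⟩
      · norm_num
      · norm_num
      · rw [hF, hz, mul_zero]
      · have h1 : (prodBernoulli w).real ((openConn a₂ a₁)ᶜ ∩ (openConn a₂ a₃)ᶜ ∩ ((openConn o a₁)ᶜ ∩ (openConn o a₃)ᶜ) ∩ (openConn a₂ o ∩ (openConn a₁ b ∩ openConn a₃ b))) = 0 := le_antisymm (le_trans (measureReal_mono Set.inter_subset_left) hz.le) measureReal_nonneg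
        rw [h1]; exact mul_nonneg (by norm_num) measureReal_nonneg
      · have h1 : (prodBernoulli w).real ((openConn a₂ a₁)ᶜ ∩ (openConn a₂ a₃)ᶜ ∩ ((openConn o a₁)ᶜ ∩ (openConn o a₃)ᶜ) ∩ openConn a₂ b) = 0 := le_antisymm (le_trans (measureReal_mono Set.inter_subset_left) hz.le) measureReal_nonneg
        rw [h1, mul_zero]; exact measureReal_nonneg
    · have hpos : 0 < (prodBernoulli w).real ((openConn a₂ a₁)ᶜ ∩ (openConn a₂ a₃)ᶜ ∩ ((openConn o a₁)ᶜ ∩ (openConn o a₃)ᶜ)) := lt_of_le_of_ne measureReal_nonneg (Ne.symm hz)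
      refine ⟨(prodBernoulli w).real ((openConn a₂ a₁)ᶜ ∩ (openConn a₂ a₃)ᶜ ∩ ((openConn o a₁)ᶜ ∩ (openConn o a₃)ᶜ) ∩ openConn a₂ o) / (prodBernoulli w).real ((openConn a₂ a₁)ᶜ ∩ (openConn a₂ a₃)ᶜ ∩ ((openConn o a₁)ᶜ ∩ (openConn o a₃)ᶜ)), ?_, ?_, ?_, ?_, ?_⟩
      · rw [le_div_iff₀ hpos]; linarith
      · rw [div_le_iff₀ hpos]; linarith
      · rw [div_mul_cancel₀ _ hpos.ne']
      · exact chart_crossAll w o b a₂ a₁ a₃ h12.symm h23 ho1 ho3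
      · exact chartP_diagOne w o b a₂ a₁ a₃ h12.symm h23 ho1 ho3
  obtain ⟨p₃, hp₃lo, hp₃hi, hidp₃, g4, g7⟩ : ∃ P : ℝ, 1 / 2 ≤ P ∧ P ≤ 3 / 4 ∧ (prodBernoulli w).real ((openConn a₃ a₁)ᶜ ∩ (openConn a₃ a₂)ᶜ ∩ ((openConn o a₁)ᶜ ∩ (openConn o a₂)ᶜ) ∩ openConn a₃ o) = P * (prodBernoulli w).real ((openConn a₃ a₁)ᶜ ∩ (openConn a₃ a₂)ᶜ ∩ ((openConn o a₁)ᶜ ∩ (openConn o a₂)ᶜ)) ∧ (prodBernoulli w).real ((openConn a₃ a₁)ᶜ ∩ (openConn a₃ a₂)ᶜ ∩ ((openConn o a₁)ᶜ ∩ (openConn o a₂)ᶜ) ∩ (openConn a₃ o ∩ (openConn a₁ b ∩ openConn a₂ b))) ≤ P * (prodBernoulli w).real ((openConn a₃ a₁)ᶜ ∩ (openConn a₃ a₂)ᶜ ∩ ((openConn o a₁)ᶜ ∩ (openConn o a₂)ᶜ) ∩ (openConn a₁ b ∩ openConn a₂ b)) ∧ P * (prodBernoulli w).real ((openConn a₃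 a₁)ᶜ ∩ (openConn a₃ a₂)ᶜ ∩ ((openConn o a₁)ᶜ ∩ (openConn o a₂)ᶜ) ∩ openConn a₃ b) ≤ (prodBernoulli w).real ((openConn a₃ a₁)ᶜ ∩ (openConn a₃ a₂)ᶜ ∩ ((openConn o a₁)ᶜ ∩ (openConn o a₂)ᶜ) ∩ (openConn a₃ o ∩ openConn a₃ b)) := by
    by_cases hz : (prodBernoulli w).real ((openConn a₃ a₁)ᶜ ∩ (openConn a₃ a₂)ᶜ ∩ ((openConn o a₁)ᶜ ∩ (openConn o a₂)ᶜ)) = 0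
    · have hF : (prodBernoulli w).real ((openConn a₃ a₁)ᶜ ∩ (openConn a₃ a₂)ᶜ ∩ ((openConn o a₁)ᶜ ∩ (openConn o a₂)ᶜ) ∩ openConn a₃ o) = 0 := le_antisymm (le_trans (measureReal_mono Set.inter_subset_left) hz.le) measureReal_nonneg
      refine ⟨((1 : ℝ) / 2), ?_, ?_, ?_, ?_, ?_⟩
      · norm_num
      · norm_num
      · rw [hF, hz, mul_zero]
      · have h1 : (prodBernoulli w).real ((openConn a₃ a₁)ᶜ ∩ (openConn a₃ a₂)ᶜ ∩ ((openConn o a₁)ᶜ ∩ (openConn o a₂)ᶜ) ∩ (openConn a₃ o ∩ (openConn a₁ b ∩ openConn a₂ b))) = 0 := le_antisymm (le_trans (measureReal_mono Set.inter_subset_left) hz.le) measureReal_nonneg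
        rw [h1]; exact mul_nonneg (by norm_num) measureReal_nonneg
      · have h1 : (prodBernoulli w).real ((openConn a₃ a₁)ᶜ ∩ (openConn a₃ a₂)ᶜ ∩ ((openConn o a₁)ᶜ ∩ (openConn o a₂)ᶜ) ∩ openConn a₃ b) = 0 := le_antisymm (le_trans (measureReal_mono Set.inter_subset_left) hz.le) measureReal_nonneg
        rw [h1, mul_zero]; exact measureReal_nonneg
    · have hpos : 0 < (prodBernoulli w).real ((openConn a₃ a₁)ᶜ ∩ (openConn a₃ a₂)ᶜ ∩ ((openConn o a₁)ᶜ ∩ (openConn o a₂)ᶜ)) := lt_of_le_of_ne measureReal_nonneg (Ne.symm hz)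
      refine ⟨(prodBernoulli w).real ((openConn a₃ a₁)ᶜ ∩ (openConn a₃ a₂)ᶜ ∩ ((openConn o a₁)ᶜ ∩ (openConn o a₂)ᶜ) ∩ openConn a₃ o) / (prodBernoulli w).real ((openConn a₃ a₁)ᶜ ∩ (openConn a₃ a₂)ᶜ ∩ ((openConn o a₁)ᶜ ∩ (openConn o a₂)ᶜ)), ?_, ?_, ?_, ?_, ?_⟩
      · rw [le_div_iff₀ hpos]; linarith
      · rw [div_le_iff₀ hpos]; linarith
      · rw [div_mul_cancel₀ _ hpos.ne']
      · exact chart_crossAll w o b a₃ a₁ a₂ h13.symm h23.symm ho1 ho2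
      · exact chartP_diagOne w o b a₃ a₁ a₂ h13.symm h23.symm ho1 ho2
  obtain ⟨p₂₃, hp₂₃lo, hp₂₃hi, hidp₂₃, g10, g11⟩ : ∃ P : ℝ, 1 / 2 ≤ P ∧ P ≤ 3 / 4 ∧ (prodBernoulli w).real ((openConn a₂ a₁)ᶜ ∩ (openConn a₃ a₁)ᶜ ∩ (openConn o a₁)ᶜ ∩ (openConn a₂ o ∪ openConn a₃ o)) = P * (prodBernoulli w).real ((openConn a₂ a₁)ᶜ ∩ (openConn a₃ a₁)ᶜ ∩ (openConn o a₁)ᶜ) ∧ (prodBernoulli w).real ((openConn a₂ a₁)ᶜ ∩ (openConn a₃ a₁)ᶜ ∩ (openConn o a₁)ᶜ ∩ ((openConn a₂ o ∪ openConn a₃ o) ∩ openConn a₁ b)) ≤ P * (prodBernoulli w).real ((openConn a₂ a₁)ᶜ ∩ (openConn a₃ a₁)ᶜ ∩ (openConn o a₁)ᶜ ∩ openConn a₁ b) ∧ P * (prodBernoulli w).real ((openConn a₂ a₁)ᶜ ∩ (openConn a₃ a₁)ᶜ ∩ (openConn o a₁)ᶜ ∩ (openConn a₂ b ∩ openConn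 a₃ b)) ≤ (prodBernoulli w).real ((openConn a₂ a₁)ᶜ ∩ (openConn a₃ a₁)ᶜ ∩ (openConn o a₁)ᶜ ∩ ((openConn a₂ o ∪ openConn a₃ o) ∩ (openConn a₂ b ∩ openConn a₃ b))) := by
    by_cases hz : (prodBernoulli w).real ((openConn a₂ a₁)ᶜ ∩ (openConn a₃ a₁)ᶜ ∩ (openConn o a₁)ᶜ) = 0
    · have hF : (prodBernoulli w).real ((openConn a₂ a₁)ᶜ ∩ (openConn a₃ a₁)ᶜ ∩ (openConn o a₁)ᶜ ∩ (openConn a₂ o ∪ openConn a₃ o)) = 0 := le_antisymm (le_trans (measureReal_mono Set.inter_subset_left) hz.le) measureReal_nonneg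
      refine ⟨((1 : ℝ) / 2), ?_, ?_, ?_, ?_, ?_⟩
      · norm_num
      · norm_num
      · rw [hF, hz, mul_zero]
      · have h1 : (prodBernoulli w).real ((openConn a₂ a₁)ᶜ ∩ (openConn a₃ a₁)ᶜ ∩ (openConn o a₁)ᶜ ∩ ((openConn a₂ o ∪ openConn a₃ o) ∩ openConn a₁ b)) = 0 := le_antisymm (le_trans (measureReal_mono Set.inter_subset_left) hz.le) measureReal_nonneg
        rw [h1]; exact mul_nonneg (by norm_num) measureReal_nonneg
      · have h1 : (prodBernoulli w).real ((openConn a₂ a₁)ᶜ ∩ (openConn a₃ a₁)ᶜ ∩ (openConn o a₁)ᶜ ∩ (openConn a₂ b ∩ openConn a₃ b)) = 0 := le_antisymm (le_trans (measureReal_mono Set.inter_subset_left) hz.le) measureReal_nonneg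
        rw [h1, mul_zero]; exact measureReal_nonneg
    · have hpos : 0 < (prodBernoulli w).real ((openConn a₂ a₁)ᶜ ∩ (openConn a₃ a₁)ᶜ ∩ (openConn o a₁)ᶜ) := lt_of_le_of_ne measureReal_nonneg (Ne.symm hz)
      refine ⟨(prodBernoulli w).real ((openConn a₂ a₁)ᶜ ∩ (openConn a₃ a₁)ᶜ ∩ (openConn o a₁)ᶜ ∩ (openConn a₂ o ∪ openConn a₃ o)) / (prodBernoulli w).real ((openConn a₂ a₁)ᶜ ∩ (openConn a₃ a₁)ᶜ ∩ (openConn o a₁)ᶜ), ?_, ?_, ?_, ?_, ?_⟩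
      · rw [le_div_iff₀ hpos]; linarith
      · rw [div_le_iff₀ hpos]; linarith
      · rw [div_mul_cancel₀ _ hpos.ne']
      · exact chartQ_crossPair w o b a₂ a₃ a₁ h12.symm h13.symm ho1
      · exact chartQ_diagPairAll w o b a₂ a₃ a₁ h12.symm h13.symm ho1
  obtain ⟨p₁₂, hp₁₂lo, hp₁₂hi, hidp₁₂, g8⟩ : ∃ P : ℝ, 1 / 2 ≤ P ∧ P ≤ 3 / 4 ∧ (prodBernoulli w).real ((openConn a₁ a₃)ᶜ ∩ (openConn a₂ a₃)ᶜ ∩ (openConn o a₃)ᶜ ∩ (openConn a₁ o ∪ openConn a₂ o)) = P * (prodBernoulli w).real ((openConn a₁ a₃)ᶜ ∩ (openConn a₂ a₃)ᶜ ∩ (openConn o a₃)ᶜ) ∧ (prodBernoulli w).real ((openConn a₁ a₃)ᶜ ∩ (openConn a₂ a₃)ᶜ ∩ (openConn o a₃)ᶜ ∩ ((openConn a₁ o ∪ openConn a₂ o) ∩ openConn a₃ b)) ≤ P * (prodBernoulli w).real ((openConn a₁ a₃)ᶜ ∩ (openConn a₂ a₃)ᶜ ∩ (openConn o a₃)ᶜ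 ∩ openConn a₃ b) := by
    by_cases hz : (prodBernoulli w).real ((openConn a₁ a₃)ᶜ ∩ (openConn a₂ a₃)ᶜ ∩ (openConn o a₃)ᶜ) = 0
    · have hF : (prodBernoulli w).real ((openConn a₁ a₃)ᶜ ∩ (openConn a₂ a₃)ᶜ ∩ (openConn o a₃)ᶜ ∩ (openConn a₁ o ∪ openConn a₂ o)) = 0 := le_antisymm (le_trans (measureReal_mono Set.inter_subset_left) hz.le) measureReal_nonneg
      refine ⟨((1 : ℝ) / 2), ?_, ?_, ?_, ?_⟩
      · norm_num
      · norm_num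
      · rw [hF, hz, mul_zero]
      · have h1 : (prodBernoulli w).real ((openConn a₁ a₃)ᶜ ∩ (openConn a₂ a₃)ᶜ ∩ (openConn o a₃)ᶜ ∩ ((openConn a₁ o ∪ openConn a₂ o) ∩ openConn a₃ b)) = 0 := le_antisymm (le_trans (measureReal_mono Set.inter_subset_left) hz.le) measureReal_nonneg
        rw [h1]; exact mul_nonneg (by norm_num) measureReal_nonneg
    · have hpos : 0 < (prodBernoulli w).real ((openConn a₁ a₃)ᶜ ∩ (openConn a₂ a₃)ᶜ ∩ (openConn o a₃)ᶜ) := lt_of_le_of_ne measureReal_nonneg (Ne.symm hz)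
      refine ⟨(prodBernoulli w).real ((openConn a₁ a₃)ᶜ ∩ (openConn a₂ a₃)ᶜ ∩ (openConn o a₃)ᶜ ∩ (openConn a₁ o ∪ openConn a₂ o)) / (prodBernoulli w).real ((openConn a₁ a₃)ᶜ ∩ (openConn a₂ a₃)ᶜ ∩ (openConn o a₃)ᶜ), ?_, ?_, ?_, ?_⟩
      · rw [le_div_iff₀ hpos]; linarith
      · rw [div_le_iff₀ hpos]; linarith
      · rw [div_mul_cancel₀ _ hpos.ne']
      · exact chartQ_crossPair w o b a₁ a₂ a₃ h13 h23 ho3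
  obtain ⟨p₁₃, hp₁₃lo, hp₁₃hi, hidp₁₃, g9⟩ : ∃ P : ℝ, 1 / 2 ≤ P ∧ P ≤ 3 / 4 ∧ (prodBernoulli w).real ((openConn a₁ a₂)ᶜ ∩ (openConn a₃ a₂)ᶜ ∩ (openConn o a₂)ᶜ ∩ (openConn a₁ o ∪ openConn a₃ o)) = P * (prodBernoulli w).real ((openConn a₁ a₂)ᶜ ∩ (openConn a₃ a₂)ᶜ ∩ (openConn o a₂)ᶜ) ∧ (prodBernoulli w).real ((openConn a₁ a₂)ᶜ ∩ (openConn a₃ a₂)ᶜ ∩ (openConn o a₂)ᶜ ∩ ((openConn a₁ o ∪ openConn a₃ o) ∩ openConn a₂ b)) ≤ P * (prodBernoulli w).real ((openConn a₁ a₂)ᶜ ∩ (openConn a₃ a₂)ᶜ ∩ (openConn o a₂)ᶜ ∩ openConn a₂ b) := by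
    by_cases hz : (prodBernoulli w).real ((openConn a₁ a₂)ᶜ ∩ (openConn a₃ a₂)ᶜ ∩ (openConn o a₂)ᶜ) = 0
    · have hF : (prodBernoulli w).real ((openConn a₁ a₂)ᶜ ∩ (openConn a₃ a₂)ᶜ ∩ (openConn o a₂)ᶜ ∩ (openConn a₁ o ∪ openConn a₃ o)) = 0 := le_antisymm (le_trans (measureReal_mono Set.inter_subset_left) hz.le) measureReal_nonneg
      refine ⟨((1 : ℝ) / 2), ?_, ?_, ?_, ?_⟩
      · norm_num
      · norm_num
      · rw [hF, hz, mul_zero]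
      · have h1 : (prodBernoulli w).real ((openConn a₁ a₂)ᶜ ∩ (openConn a₃ a₂)ᶜ ∩ (openConn o a₂)ᶜ ∩ ((openConn a₁ o ∪ openConn a₃ o) ∩ openConn a₂ b)) = 0 := le_antisymm (le_trans (measureReal_mono Set.inter_subset_left) hz.le) measureReal_nonneg
        rw [h1]; exact mul_nonneg (by norm_num) measureReal_nonneg
    · have hpos : 0 < (prodBernoulli w).real ((openConn a₁ a₂)ᶜ ∩ (openConn a₃ a₂)ᶜ ∩ (openConn o a₂)ᶜ) := lt_of_le_of_ne measureReal_nonneg (Ne.symm hz)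
      refine ⟨(prodBernoulli w).real ((openConn a₁ a₂)ᶜ ∩ (openConn a₃ a₂)ᶜ ∩ (openConn o a₂)ᶜ ∩ (openConn a₁ o ∪ openConn a₃ o)) / (prodBernoulli w).real ((openConn a₁ a₂)ᶜ ∩ (openConn a₃ a₂)ᶜ ∩ (openConn o a₂)ᶜ), ?_, ?_, ?_, ?_⟩
      · rw [le_div_iff₀ hpos]; linarith
      · rw [div_le_iff₀ hpos]; linarith
      · rw [div_mul_cancel₀ _ hpos.ne']
      · exact chartQ_crossPair w o b a₁ a₃ a₂ h12 h23.symm ho2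
  have hpt := fun ω => chartS_pointwise n o b a₁ a₂ a₃ p₁ hp₁lo hp₁hi p₂ hp₂lo hp₂hi p₃ hp₃lo hp₃hi p₂₃ hp₂₃lo hp₂₃hi p₁₂ hp₁₂lo hp₁₂hi p₁₃ hp₁₃lo hp₁₃hi ω
  have hint := stub_lincombIntegral_c7 n w _ hpt
  simp only [List.map_cons, List.map_nil, List.sum_cons, List.sum_nil, add_zero] at hint
  have e0 := stub_exchangeHas_c7 n w a₁ a₂ o b hτ12
  have e1 := stub_exchangeAvoid_c7 n w a₁ a₂ o b hτ12
  have e2 := stub_exchangePlain_c7 n w a₃ a₁ b hτ31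
  have e3 := stub_exchangeHas_c7 n w a₃ a₁ o b hτ31
  have e4 := stub_exchangeAvoid_c7 n w a₃ a₁ o b hτ31
  have e5 := stub_exchangeHas_c7 n w a₃ a₂ o b hτ32
  have e6 := stub_exchangeAvoid_c7 n w a₃ a₂ o b hτ32
  nlinarith [hint, hidp₁, g1, g2, g5, hidp₂, g3, g6, hidp₃, g4, g7, hidp₂₃, g10, g11, hidp₁₂, g8, hidp₁₃, g9, e0, e1, e2, e3, e4, e5, e6, hreg]

end Summit.CriticalPhenomena.PercolationContinuityZ3.Theorems
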